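import Summits.AnomalousDissipation.AnomalousDissipation.Theorems.SolenoidalFractalHomogenisationLagrangianStepCellChainSlotWindow
import Summits.AnomalousDissipation.AnomalousDissipation.Theorems.SolenoidalFractalHomogenisationLagrangianStepCellChainPair
import HarnessLib

/-!
# K1L_D `LagrangianRenormalisationStepDesign` (stmt-AnomalousDissipation-27980), W7 engine sub-piece S1a: the INPUTS of `W7Slot.slot_step` on one slot window,
# in its exact hypothesis shapes (helper; `--supports stmt-AnomalousDissipation-27980`)

Summits-side helper file of route `SolenoidalFractalHomogenisation` (prover seat `ad-k1l-cellLawV-w1` g4; the S1a side of the assembly owner's per-slot adapter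
(R-a), STATUS 22:16:05Z / 22:5xZ).  Everything proved; no definitions, no named facts, no sorry.  On the absolute window `[t₀, t₁] = [pP + start s,
pP + start s + τ_s] ⊆ [0,T]` of slot `s` in period `p` of the word `W₁` driving the cell problem `IsWeakTensorPassiveVectorOn 0 T 𝔹 (W₁.cell n) F u`, with the
five gauged representatives `wⱼ t = μ^j • modeRep … (K₀ + j·K_s) t`, `j ∈ {0, ±1, ±2}` (`μ = σ·conj e^{iφ_s}`), this file serves the hypotheses of
`W7Slot.slot_step` (p673119): transversality on `[0,T]` (`kdot_gauge_modeRep`), absolute continuity on `[t₀,t₁]` (`absolutelyContinuousOnInterval_gauge_modeRep`),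
the chain ODE on `uIcc t₀ t₁` (`ae_uIcc_hasDerivAt_dW0C/_dWpC/_dWmC`, link `c_s·A(t)`, `A t = trapezoid t₀ τ_s ramp t`), the energy (`ae_uIcc_hasDerivAt_energy`
in the `-2 * Q t` form), the five-mode energy sandwich EVERYWHERE on the window (`five_norm_sq_le_energy`, from the a.e. Bessel bound by continuity:
`le_on_Icc_of_ae_le`) and the conjugate-pair dissipation split on `uIcc t₀ t₁` in the five-term order of `slot_step` (`ae_uIcc_pair_split`).
NOT a proof of any registered stub, of the crux, or of anomalous dissipation; rung F-D1.A0 infrastructure.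
-/

set_option linter.dupNamespace false

noncomputable section

namespace Summit.AnomalousDissipation.AnomalousDissipation.Theorems.SolenoidalFractalHomogenisation.LagrangianStep.CellChain

open Set MeasureTheory Filter Topology Function Complex UnitAddTorus
open scoped InnerProductSpace ComplexConjugate ENNReal
open Literature.Analysis Literature.Analysis.FunctionSpaces Literature.Analysis.FunctionSpaces.Torus
open Literature.Analysis.FluidPDE Literature.Analysis.FluidPDE.Torus Literature.Analysis.FluidPDE.LatticeShear
open Summit.AnomalousDissipation.AnomalousDissipation.Theorems.SolenoidalFractalHomogenisation.RealisedQuasiStaticCellLaw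
open Summit.AnomalousDissipation.AnomalousDissipation.Theorems.SolenoidalFractalHomogenisation.PermissibleCarrier
open Summit.AnomalousDissipation.AnomalousDissipation.Theorems.SolenoidalFractalHomogenisation.LagrangianStep.ThreeMode

variable {k₀ : ℕ}

/-! ## §0 Tools: a.e. facts on `(0,T)` read on a window; a.e. + continuity ⇒ everywhere -/

/-- An a.e. statement on `(0,T)` conditioned on the half-open window `Ico t₀ t₁ ⊆ [0,T]` holds a.e. on `uIcc t₀ t₁` (the three exceptional points
`0, T, t₁` are null). [folklore] -/
theorem ae_uIcc_of_ae_window {T t₀ t₁ : ℝ} (h0 : 0 ≤ t₀) (h01 : t₀ ≤ t₁) (h1 : t₁ ≤ T) {P : ℝ → Prop}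
    (h : ∀ᵐ t ∂(volume.restrict (Ioo 0 T)), t ∈ Ico t₀ t₁ → P t) :
    ∀ᵐ t ∂(volume : Measure ℝ), t ∈ uIcc t₀ t₁ → P t := by
  have h' : ∀ᵐ t ∂(volume : Measure ℝ), t ∈ Ioo 0 T → t ∈ Ico t₀ t₁ → P t := (ae_restrict_iff' measurableSet_Ioo).1 h
  have hne : ∀ x : ℝ, ∀ᵐ t ∂(volume : Measure ℝ), t ≠ x := fun x => by
    have : ({x}ᶜ : Set ℝ) ∈ ae (volume : Measure ℝ) := compl_mem_ae_iff.2 (measure_singleton _)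
    filter_upwards [this] with s hs
    simpa using hs
  filter_upwards [h', hne 0, hne T, hne t₁] with t ht ht0 htT ht1 htI
  rw [uIcc_of_le h01] at htI
  exact ht ⟨lt_of_le_of_ne (h0.trans htI.1) (Ne.symm ht0), lt_of_le_of_ne (htI.2.trans h1) htT⟩ ⟨htI.1, lt_of_le_of_ne htI.2 ht1⟩

/-- An a.e. statement on `(0,T)` holds a.e. on `uIcc t₀ t₁ ⊆ [0,T]`. [folklore] -/
theorem ae_uIcc_of_ae_Ioo {T t₀ t₁ : ℝ} (h0 : 0 ≤ t₀) (h01 : t₀ ≤ t₁) (h1 : t₁ ≤ T) {P : ℝ → Prop}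
    (h : ∀ᵐ t ∂(volume.restrict (Ioo 0 T)), P t) :
    ∀ᵐ t ∂(volume : Measure ℝ), t ∈ uIcc t₀ t₁ → P t := by
  have h' : ∀ᵐ t ∂(volume : Measure ℝ), t ∈ Ioo 0 T → P t := (ae_restrict_iff' measurableSet_Ioo).1 h
  have hne : ∀ x : ℝ, ∀ᵐ t ∂(volume : Measure ℝ), t ≠ x := fun x => by
    have : ({x}ᶜ : Set ℝ) ∈ ae (volume : Measure ℝ) := compl_mem_ae_iff.2 (measure_singleton _)
    filter_upwards [this] with s hs
    simpa using hs
  filter_upwards [h', hne 0, hne T] with t ht ht0 htT htI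
  rw [uIcc_of_le h01] at htI
  exact ht ⟨lt_of_le_of_ne (h0.trans htI.1) (Ne.symm ht0), lt_of_le_of_ne (htI.2.trans h1) htT⟩

/-- **a.e. + continuity ⇒ everywhere**: if `f, g` are continuous on `[a,b]` (`a < b`) and `f ≤ g` a.e. on `(a,b)`, then `f ≤ g` on `[a,b]`. [folklore] -/
theorem le_on_Icc_of_ae_le {f g : ℝ → ℝ} {a b : ℝ} (hab : a < b) (hf : ContinuousOn f (Icc a b)) (hg : ContinuousOn g (Icc a b))
    (h : ∀ᵐ t ∂(volume.restrict (Ioo a b)), f t ≤ g t) : ∀ t ∈ Icc a b, f t ≤ g t := by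
  by_contra hcon
  simp only [not_forall, not_le, exists_prop] at hcon
  obtain ⟨t₀, ht₀, hlt⟩ := hcon
  -- `g - f < 0` near `t₀` within `[a,b]`
  have hc : ContinuousWithinAt (fun t => g t - f t) (Icc a b) t₀ := (hg.sub hf) t₀ ht₀
  have hneg : g t₀ - f t₀ < 0 := by linarith
  obtain ⟨δ, hδ, hδ'⟩ := Metric.continuousWithinAt_iff.1 hc (f t₀ - g t₀) (by linarith)
  -- an open interval inside `(a,b) ∩ ball t₀ δ`
  set l : ℝ := max a (t₀ - δ / 2) with hl
  set r : ℝ := min b (t₀ + δ / 2) with hr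
  have hlr : l < r := by
    simp only [hl, hr, max_lt_iff, lt_min_iff]
    refine ⟨⟨hab, by linarith [ht₀.1, ht₀.2]⟩, ⟨by linarith [ht₀.1, ht₀.2], by linarith⟩⟩
  have hbad : ∀ t ∈ Ioo l r, ¬ f t ≤ g t := by
    intro t ht hle
    have hta : t ∈ Icc a b := ⟨(le_max_left _ _).trans ht.1.le, ht.2.le.trans (min_le_left _ _)⟩
    have hdist : dist t t₀ < δ := by
      rw [Real.dist_eq, abs_lt]
      have h1 : t₀ - δ / 2 ≤ l := le_max_right _ _
      have h2 : r ≤ t₀ + δ / 2 := min_le_right _ _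
      constructor <;> linarith [ht.1, ht.2]
    have := hδ' hta hdist
    rw [Real.dist_eq, abs_lt] at this
    linarith [this.1, this.2]
  -- this interval has positive measure but is contained in the null set
  have hsub : Ioo l r ⊆ {t | ¬ f t ≤ g t} ∩ Ioo a b := fun t ht =>
    ⟨hbad t ht, ⟨lt_of_le_of_lt (le_max_left _ _) ht.1, lt_of_lt_of_le ht.2 (min_le_left _ _)⟩⟩
  have hnull : volume ({t | ¬ f t ≤ g t} ∩ Ioo a b) = 0 := by
    have := (ae_restrict_iff' (μ := volume) measurableSet_Ioo).1 h
    rw [ae_iff] at this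
    convert this using 2
    ext t
    simp only [mem_inter_iff, mem_setOf_eq, Classical.not_imp]
    tauto
  have hpos : 0 < volume (Ioo l r) := by rw [Real.volume_Ioo]; exact ENNReal.ofReal_pos.2 (by linarith)
  exact absurd (measure_mono_null hsub hnull) hpos.ne'

/-! ## §1 Transversality and absolute continuity of the gauged representatives -/

/-- `kdot K (c • modeRep … K t) = 0` on `[0,T]`. [cite: Temam1984, Ch. III §1.1] -/
theorem kdot_gauge_modeRep (W₁ : LatticeWord k₀) (n : ℕ) {T : ℝ} (hT : 0 ≤ T) {𝔹 : Torus.Visc4 (Fin 3)}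
    {F : UnitAddTorus (Fin 3) → EuclideanSpace ℝ (Fin 3)} {u : ℝ → UnitAddTorus (Fin 3) → EuclideanSpace ℝ (Fin 3)}
    (h : Torus.IsWeakTensorPassiveVectorOn 0 T 𝔹 (W₁.cell n) F u) (c : ℂ) (K : Fin 3 → ℤ) {t : ℝ} (ht : t ∈ Icc 0 T) :
    kdot K (c • modeRep W₁ n 𝔹 F u K t) = 0 := by
  have h1 := kdot_modeRep W₁ n hT h K ht
  rw [LinearMap.map_smul, h1, smul_zero]

/-- `t ↦ c • modeRep … K t` is absolutely continuous on every `[t₀,t₁] ⊆ [0,T]`. [cite: Temam1984, Ch. III §1.1] -/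
theorem absolutelyContinuousOnInterval_gauge_modeRep (W₁ : LatticeWord k₀) (n : ℕ) {T : ℝ} (hT : 0 ≤ T) {𝔹 : Torus.Visc4 (Fin 3)}
    {F : UnitAddTorus (Fin 3) → EuclideanSpace ℝ (Fin 3)} {u : ℝ → UnitAddTorus (Fin 3) → EuclideanSpace ℝ (Fin 3)}
    (h : Torus.IsWeakTensorPassiveVectorOn 0 T 𝔹 (W₁.cell n) F u) (c : ℂ) (K : Fin 3 → ℤ) {t₀ t₁ : ℝ} (ht₀ : t₀ ∈ Icc 0 T)
    (ht₁ : t₁ ∈ Icc 0 T) :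
    AbsolutelyContinuousOnInterval (fun t => c • modeRep W₁ n 𝔹 F u K t) t₀ t₁ :=
  (absolutelyContinuousOnInterval_modeRep W₁ n hT h K ht₀ ht₁).const_smul c

/-- `t ↦ c • modeRep … K t` is continuous on `[0,T]`, and so is the square of its norm. [cite: Temam1984, Ch. III §1.1] -/
theorem continuousOn_norm_sq_gauge_modeRep (W₁ : LatticeWord k₀) (n : ℕ) {T : ℝ} (hT : 0 ≤ T) {𝔹 : Torus.Visc4 (Fin 3)}
    {F : UnitAddTorus (Fin 3) → EuclideanSpace ℝ (Fin 3)} {u : ℝ → UnitAddTorus (Fin 3) → EuclideanSpace ℝ (Fin 3)}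
    (h : Torus.IsWeakTensorPassiveVectorOn 0 T 𝔹 (W₁.cell n) F u) (c : ℂ) (K : Fin 3 → ℤ) :
    ContinuousOn (fun t => ‖c • modeRep W₁ n 𝔹 F u K t‖ ^ 2) (Icc 0 T) := by
  have h1 : ContinuousOn (fun t => c • modeRep W₁ n 𝔹 F u K t) (Icc 0 T) := (continuousOn_modeRep W₁ n hT h K).const_smul c
  exact h1.norm.pow 2

/-! ## §2 The energy on the window -/

/-- The energy derivative on `uIcc t₀ t₁ ⊆ [0,T]`, in the `-2 * Q t` form of `slot_step`. [cite: Temam1984, Ch. III §1 Lemma 1.2 (energy inequality)] -/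
theorem ae_uIcc_hasDerivAt_energy {T t₀ t₁ : ℝ} (h0 : 0 ≤ t₀) (h01 : t₀ ≤ t₁) (h1 : t₁ ≤ T) {E Q : ℝ → ℝ}
    (hd : ∀ᵐ t ∂(volume : Measure ℝ), t ∈ Ioo 0 T → HasDerivAt E (-(2 * Q t)) t) :
    ∀ᵐ t ∂(volume : Measure ℝ), t ∈ uIcc t₀ t₁ → HasDerivAt E (-2 * Q t) t := by
  have h' : ∀ᵐ t ∂(volume.restrict (Ioo 0 T)), HasDerivAt E (-(2 * Q t)) t := (ae_restrict_iff' measurableSet_Ioo).2 hd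
  filter_upwards [ae_uIcc_of_ae_Ioo h0 h01 h1 h'] with t ht htI
  have := ht htI
  rwa [show -(2 * Q t) = -2 * Q t by ring] at this


/-! ## §3 The chain ODE on `uIcc t₀ t₁` (slot_step's `hd0 / hdp' / hdm'`) -/

/-- `hd0` of `slot_step` on the window of slot `s`, period `p` (`[t₀,t₁] ⊆ [0,T]`). [cite: BedrossianCotiZelati2017, §2 (hypocoercivity functional with a cross term)] -/
theorem ae_uIcc_hasDerivAt_dW0C (W₁ : LatticeWord k₀) (n : ℕ) {T : ℝ} (hT : 0 ≤ T) {𝔹 : Torus.Visc4 (Fin 3)}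
    {F : UnitAddTorus (Fin 3) → EuclideanSpace ℝ (Fin 3)} {u : ℝ → UnitAddTorus (Fin 3) → EuclideanSpace ℝ (Fin 3)}
    (h : Torus.IsWeakTensorPassiveVectorOn 0 T 𝔹 (W₁.cell n) F u) (hF : Integrable F volume) (s : Fin k₀) (K0 : Fin 3 → ℤ)
    {σ : ℝ} (hσ : σ = 1 ∨ σ = -1) (p : ℤ) (h0 : 0 ≤ p * W₁.period + W₁.start s) (h1 : p * W₁.period + W₁.start s + (W₁.phase s).τ ≤ T) :
    ∀ᵐ t ∂(volume : Measure ℝ), t ∈ uIcc (p * W₁.period + W₁.start s) (p * W₁.period + W₁.start s + (W₁.phase s).τ) →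
      HasDerivAt (fun x => ((σ : ℂ) * starRingEnd ℂ (Complex.exp ((W₁.phase s).φ * Complex.I))) ^ (0:ℤ) • modeRep W₁ n 𝔹 F u (K0 + (0:ℤ) • (fun i => (W₁.phase s).m i * (n : ℤ))) x)
        (dW0C ((σ * (∑ a, (W₁.phase s).e a * (K0 a : ℝ)) * (1 / (n : ℝ)) / (2 * ‖latticeVec (W₁.phase s).m‖)) * LatticeWord.trapezoid (p * W₁.period + W₁.start s) (W₁.phase s).τ W₁.ramp t) (K0 + (0:ℤ) • (fun i => (W₁.phase s).m i * (n : ℤ))) (((σ : ℂ) * starRingEnd ℂ (Complex.exp ((W₁.phase s).φ * Complex.I))) ^ (1:ℤ) • modeRep W₁ n 𝔹 F u (K0 + (1:ℤ) • (fun i => (W₁.phase s).m i * (n : ℤ))) t) (((σ : ℂ) * starRingEnd ℂ (Complex.exp ((W₁.phase s).φ * Complex.I))) ^ (-1:ℤ) • modeRep W₁ n 𝔹 F u (K0 + (-1:ℤ) • (fun i => (W₁.phase s).m i * (n : ℤ))) t)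
          (Torus.modalAdjGen (Torus.majorTranspose 𝔹) (K0 + (0:ℤ) • (fun i => (W₁.phase s).m i * (n : ℤ))) (((σ : ℂ) * starRingEnd ℂ (Complex.exp ((W₁.phase s).φ * Complex.I))) ^ (0:ℤ) • modeRep W₁ n 𝔹 F u (K0 + (0:ℤ) • (fun i => (W₁.phase s).m i * (n : ℤ))) t))) t :=
  ae_uIcc_of_ae_window h0 (by linarith [(W₁.phase s).τ_pos]) h1
    ((ae_hasDerivAt_window_dW0C W₁ n hT h hF s K0 hσ).mono fun t ht hmem => ht p hmem)

/-- `hdp'` of `slot_step` on the window. [cite: BedrossianCotiZelati2017, §2 (hypocoercivity functional with a cross term)] -/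
theorem ae_uIcc_hasDerivAt_dWpC (W₁ : LatticeWord k₀) (n : ℕ) {T : ℝ} (hT : 0 ≤ T) {𝔹 : Torus.Visc4 (Fin 3)}
    {F : UnitAddTorus (Fin 3) → EuclideanSpace ℝ (Fin 3)} {u : ℝ → UnitAddTorus (Fin 3) → EuclideanSpace ℝ (Fin 3)}
    (h : Torus.IsWeakTensorPassiveVectorOn 0 T 𝔹 (W₁.cell n) F u) (hF : Integrable F volume) (s : Fin k₀) (K0 : Fin 3 → ℤ)
    {σ : ℝ} (hσ : σ = 1 ∨ σ = -1) (p : ℤ) (h0 : 0 ≤ p * W₁.period + W₁.start s) (h1 : p * W₁.period + W₁.start s + (W₁.phase s).τ ≤ T) :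
    ∀ᵐ t ∂(volume : Measure ℝ), t ∈ uIcc (p * W₁.period + W₁.start s) (p * W₁.period + W₁.start s + (W₁.phase s).τ) →
      HasDerivAt (fun x => ((σ : ℂ) * starRingEnd ℂ (Complex.exp ((W₁.phase s).φ * Complex.I))) ^ (1:ℤ) • modeRep W₁ n 𝔹 F u (K0 + (1:ℤ) • (fun i => (W₁.phase s).m i * (n : ℤ))) x)
        (dWpC ((σ * (∑ a, (W₁.phase s).e a * (K0 a : ℝ)) * (1 / (n : ℝ)) / (2 * ‖latticeVec (W₁.phase s).m‖)) * LatticeWord.trapezoid (p * W₁.period + W₁.start s) (W₁.phase s).τ W₁.ramp t) (K0 + (1:ℤ) • (fun i => (W₁.phase s).m i * (n : ℤ))) (((σ : ℂ) * starRingEnd ℂ (Complex.exp ((W₁.phase s).φ * Complex.I))) ^ (0:ℤ) • modeRep W₁ n 𝔹 F u (K0 + (0:ℤ) • (fun i => (W₁.phase s).m i * (n : ℤ))) t) (((σ : ℂ) * starRingEnd ℂ (Complex.exp ((W₁.phase s).φ * Complex.I))) ^ (2:ℤ) • modeRep W₁ n 𝔹 F u (K0 + (2:ℤ) • (fun i =>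 (W₁.phase s).m i * (n : ℤ))) t)
          (Torus.modalAdjGen (Torus.majorTranspose 𝔹) (K0 + (1:ℤ) • (fun i => (W₁.phase s).m i * (n : ℤ))) (((σ : ℂ) * starRingEnd ℂ (Complex.exp ((W₁.phase s).φ * Complex.I))) ^ (1:ℤ) • modeRep W₁ n 𝔹 F u (K0 + (1:ℤ) • (fun i => (W₁.phase s).m i * (n : ℤ))) t))) t :=
  ae_uIcc_of_ae_window h0 (by linarith [(W₁.phase s).τ_pos]) h1
    ((ae_hasDerivAt_window_dWpC W₁ n hT h hF s K0 hσ).mono fun t ht hmem => ht p hmem)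

/-- `hdm'` of `slot_step` on the window. [cite: BedrossianCotiZelati2017, §2 (hypocoercivity functional with a cross term)] -/
theorem ae_uIcc_hasDerivAt_dWmC (W₁ : LatticeWord k₀) (n : ℕ) {T : ℝ} (hT : 0 ≤ T) {𝔹 : Torus.Visc4 (Fin 3)}
    {F : UnitAddTorus (Fin 3) → EuclideanSpace ℝ (Fin 3)} {u : ℝ → UnitAddTorus (Fin 3) → EuclideanSpace ℝ (Fin 3)}
    (h : Torus.IsWeakTensorPassiveVectorOn 0 T 𝔹 (W₁.cell n) F u) (hF : Integrable F volume) (s : Fin k₀) (K0 : Fin 3 → ℤ)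
    {σ : ℝ} (hσ : σ = 1 ∨ σ = -1) (p : ℤ) (h0 : 0 ≤ p * W₁.period + W₁.start s) (h1 : p * W₁.period + W₁.start s + (W₁.phase s).τ ≤ T) :
    ∀ᵐ t ∂(volume : Measure ℝ), t ∈ uIcc (p * W₁.period + W₁.start s) (p * W₁.period + W₁.start s + (W₁.phase s).τ) →
      HasDerivAt (fun x => ((σ : ℂ) * starRingEnd ℂ (Complex.exp ((W₁.phase s).φ * Complex.I))) ^ (-1:ℤ) • modeRep W₁ n 𝔹 F u (K0 + (-1:ℤ) • (fun i => (W₁.phase s).m i * (n : ℤ))) x)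
        (dWmC ((σ * (∑ a, (W₁.phase s).e a * (K0 a : ℝ)) * (1 / (n : ℝ)) / (2 * ‖latticeVec (W₁.phase s).m‖)) * LatticeWord.trapezoid (p * W₁.period + W₁.start s) (W₁.phase s).τ W₁.ramp t) (K0 + (-1:ℤ) • (fun i => (W₁.phase s).m i * (n : ℤ))) (((σ : ℂ) * starRingEnd ℂ (Complex.exp ((W₁.phase s).φ * Complex.I))) ^ (0:ℤ) • modeRep W₁ n 𝔹 F u (K0 + (0:ℤ) • (fun i => (W₁.phase s).m i * (n : ℤ))) t) (((σ : ℂ) * starRingEnd ℂ (Complex.exp ((W₁.phase s).φ * Complex.I))) ^ (-2:ℤ) • modeRep W₁ n 𝔹 F u (K0 + (-2:ℤ) • (fun i => (W₁.phase s).m i * (n : ℤ))) t)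
          (Torus.modalAdjGen (Torus.majorTranspose 𝔹) (K0 + (-1:ℤ) • (fun i => (W₁.phase s).m i * (n : ℤ))) (((σ : ℂ) * starRingEnd ℂ (Complex.exp ((W₁.phase s).φ * Complex.I))) ^ (-1:ℤ) • modeRep W₁ n 𝔹 F u (K0 + (-1:ℤ) • (fun i => (W₁.phase s).m i * (n : ℤ))) t))) t :=
  ae_uIcc_of_ae_window h0 (by linarith [(W₁.phase s).τ_pos]) h1
    ((ae_hasDerivAt_window_dWmC W₁ n hT h hF s K0 hσ).mono fun t ht hmem => ht p hmem)

/-! ## §4 The five-mode energy sandwich everywhere on `[0,T]` (slot_step's `hE5`, multiplicity `2`) -/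

/-- Folding a mirror-symmetric sum over the ten vectors `±(K₀ + jK_s)` onto the five `K₀ + jK_s`. [folklore] -/
theorem sum_window_pair_eq {K0 Ks : Fin 3 → ℤ} (hKs : Ks ≠ 0)
    (hdisj : ∀ j ∈ ({-2, -1, 0, 1, 2} : Finset ℤ), ∀ j' ∈ ({-2, -1, 0, 1, 2} : Finset ℤ), K0 + j • Ks ≠ -(K0 + j' • Ks))
    (f : (Fin 3 → ℤ) → ℝ) (hf : ∀ k, f (-k) = f k) :
    ∑ k ∈ ({-2, -1, 0, 1, 2} : Finset ℤ).image (fun j : ℤ => K0 + j • Ks) ∪ ({-2, -1, 0, 1, 2} : Finset ℤ).image (fun j : ℤ => -(K0 + j • Ks)), f k =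
      2 * ∑ j ∈ ({-2, -1, 0, 1, 2} : Finset ℤ), f (K0 + j • Ks) := by
  classical
  set S5 : Finset ℤ := ({-2, -1, 0, 1, 2} : Finset ℤ) with hS5
  have hinj : Set.InjOn (fun j : ℤ => K0 + j • Ks) ↑S5 := by
    intro j _ j' _ hjj'
    have h1 : (j - j') • Ks = 0 := by rw [sub_zsmul]; exact sub_eq_zero.2 (add_left_cancel hjj')
    rcases smul_eq_zero.1 h1 with h | h
    · exact sub_eq_zero.1 h
    · exact absurd h hKs
  have hinj' : Set.InjOn (fun j : ℤ => -(K0 + j • Ks)) ↑S5 := fun j hj j' hj' hjj' => hinj hj hj' (neg_injective hjj')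
  have hWdisj : Disjoint (S5.image (fun j : ℤ => K0 + j • Ks)) (S5.image (fun j : ℤ => -(K0 + j • Ks))) := by
    rw [Finset.disjoint_left]
    intro k hk hk'
    rw [Finset.mem_image] at hk hk'
    obtain ⟨j, hj, rfl⟩ := hk
    obtain ⟨j', hj', hjj'⟩ := hk'
    exact hdisj j hj j' hj' hjj'.symm
  rw [Finset.sum_union hWdisj, Finset.sum_image hinj, Finset.sum_image hinj', two_mul]
  congr 1
  exact Finset.sum_congr rfl fun j _ => hf _

/-- A sum over `{−2, −1, 0, 1, 2}` written out in the order `0, 1, −1, 2, −2` of `slot_step`. [folklore] -/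
theorem sum_S5_eq (g : ℤ → ℝ) :
    ∑ j ∈ ({-2, -1, 0, 1, 2} : Finset ℤ), g j = g 0 + g 1 + g (-1) + g 2 + g (-2) := by
  rw [Finset.sum_insert (by norm_num), Finset.sum_insert (by norm_num), Finset.sum_insert (by norm_num),
    Finset.sum_insert (by norm_num), Finset.sum_singleton]
  ring

/-- **`hE5` of `slot_step` with multiplicity `2`, EVERYWHERE on `[0,T]`**: `2·Σ_{j∈{0,±1,±2}} ‖w̃ⱼ t‖² ≤ E t` for all `t ∈ [0,T]`
(a.e. by finite Bessel + reality + gauge, then everywhere by continuity of both sides). [cite: Grafakos2014, Prop. 3.2.7 (3)] -/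
theorem five_norm_sq_le_energy (W₁ : LatticeWord k₀) (n : ℕ) {T : ℝ} (hT : 0 < T) {𝔹 : Torus.Visc4 (Fin 3)}
    {F : UnitAddTorus (Fin 3) → EuclideanSpace ℝ (Fin 3)} {u : ℝ → UnitAddTorus (Fin 3) → EuclideanSpace ℝ (Fin 3)}
    (h : Torus.IsWeakTensorPassiveVectorOn 0 T 𝔹 (W₁.cell n) F u) (hF : Integrable F volume) (s : Fin k₀) (K0 : Fin 3 → ℤ)
    {σ : ℝ} (hσ : σ = 1 ∨ σ = -1) (hKs : (fun i => (W₁.phase s).m i * (n : ℤ)) ≠ 0)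
    (hdisj : ∀ j ∈ ({-2, -1, 0, 1, 2} : Finset ℤ), ∀ j' ∈ ({-2, -1, 0, 1, 2} : Finset ℤ),
      K0 + j • (fun i => (W₁.phase s).m i * (n : ℤ)) ≠ -(K0 + j' • (fun i => (W₁.phase s).m i * (n : ℤ))))
    {E : ℝ → ℝ} (hEc : ContinuousOn E (Icc 0 T)) (hE : ∀ᵐ t ∂(volume.restrict (Ioo 0 T)), E t = ∫ x, ‖u t x‖ ^ 2) :
    ∀ t ∈ Icc 0 T, 2 * (‖((σ : ℂ) * starRingEnd ℂ (Complex.exp ((W₁.phase s).φ * Complex.I))) ^ (0:ℤ) • modeRep W₁ n 𝔹 F u (K0 + (0:ℤ) • (fun i => (W₁.phase s).m i * (n : ℤ))) t‖ ^ 2 + ‖((σ : ℂ) * starRingEnd ℂ (Complex.exp ((W₁.phase s).φ * Complex.I))) ^ (1:ℤ) • modeRep W₁ n 𝔹 F u (K0 + (1:ℤ) • (fun i => (W₁.phase s).m i * (n : ℤ))) t‖ ^ 2 + ‖((σ : ℂ) * starRingEnd ℂ (Complex.exp ((W₁.phase s).φ * Complex.I))) ^ (-1:ℤ) • modeRep W₁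 n 𝔹 F u (K0 + (-1:ℤ) • (fun i => (W₁.phase s).m i * (n : ℤ))) t‖ ^ 2 + ‖((σ : ℂ) * starRingEnd ℂ (Complex.exp ((W₁.phase s).φ * Complex.I))) ^ (2:ℤ) • modeRep W₁ n 𝔹 F u (K0 + (2:ℤ) • (fun i => (W₁.phase s).m i * (n : ℤ))) t‖ ^ 2 + ‖((σ : ℂ) * starRingEnd ℂ (Complex.exp ((W₁.phase s).φ * Complex.I))) ^ (-2:ℤ) • modeRep W₁ n 𝔹 F u (K0 + (-2:ℤ) • (fun i => (W₁.phase s).m i * (n : ℤ))) t‖ ^ 2) ≤ E t := by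
  classical
  set S5 : Finset ℤ := ({-2, -1, 0, 1, 2} : Finset ℤ) with hS5
  set W10 : Finset (Fin 3 → ℤ) := S5.image (fun j : ℤ => K0 + j • (fun i => (W₁.phase s).m i * (n : ℤ))) ∪ S5.image (fun j : ℤ => -(K0 + j • (fun i => (W₁.phase s).m i * (n : ℤ)))) with hW10
  -- a.e. on `(0,T)`
  have hae : ∀ᵐ t ∂(volume.restrict (Ioo 0 T)), 2 * (‖((σ : ℂ) * starRingEnd ℂ (Complex.exp ((W₁.phase s).φ * Complex.I))) ^ (0:ℤ) • modeRep W₁ n 𝔹 F u (K0 + (0:ℤ) • (fun i => (W₁.phase s).m i * (n : ℤ))) t‖ ^ 2 + ‖((σ : ℂ) * starRingEnd ℂ (Complex.exp ((W₁.phase s).φ * Complex.I))) ^ (1:ℤ) • modeRep W₁ n 𝔹 F u (K0 + (1:ℤ) • (fun i => (W₁.phase s).m i * (n : ℤ))) t‖ ^ 2 + ‖((σ : ℂ) * starRingEnd ℂ (Complex.exp ((W₁.phase s).φ * Complex.I))) ^ (-1:ℤ) • modeRep W₁ n 𝔹 F u (K0 + (-1:ℤ) • (fun i => (W₁.phase s).m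 i * (n : ℤ))) t‖ ^ 2 + ‖((σ : ℂ) * starRingEnd ℂ (Complex.exp ((W₁.phase s).φ * Complex.I))) ^ (2:ℤ) • modeRep W₁ n 𝔹 F u (K0 + (2:ℤ) • (fun i => (W₁.phase s).m i * (n : ℤ))) t‖ ^ 2 + ‖((σ : ℂ) * starRingEnd ℂ (Complex.exp ((W₁.phase s).φ * Complex.I))) ^ (-2:ℤ) • modeRep W₁ n 𝔹 F u (K0 + (-2:ℤ) • (fun i => (W₁.phase s).m i * (n : ℤ))) t‖ ^ 2) ≤ E t := by
    filter_upwards [sum_sq_norm_mFourierCoeff_le W₁ n h W10, ae_forall_eq_modeRep W₁ n hT.le h hF, hE, h.ae_integrable_slice]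
      with t hB hrep hEt hint
    rw [hW10, sum_window_pair_eq hKs hdisj _ (fun k => by rw [norm_mFourierCoeff_neg hint.1]), hEt.symm] at hB
    simp only [hrep] at hB
    have e : ∑ j ∈ ({-2, -1, 0, 1, 2} : Finset ℤ), ‖modeRep W₁ n 𝔹 F u (K0 + j • (fun i => (W₁.phase s).m i * (n : ℤ))) t‖ ^ 2 =
        ∑ j ∈ ({-2, -1, 0, 1, 2} : Finset ℤ), ‖((σ : ℂ) * starRingEnd ℂ (Complex.exp ((W₁.phase s).φ * Complex.I))) ^ j • modeRep W₁ n 𝔹 F u (K0 + j • (fun i => (W₁.phase s).m i * (n : ℤ))) t‖ ^ 2 :=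
      Finset.sum_congr rfl fun j _ => by rw [norm_zpow_gauge_smul hσ]
    rw [e, sum_S5_eq (fun j => ‖((σ : ℂ) * starRingEnd ℂ (Complex.exp ((W₁.phase s).φ * Complex.I))) ^ j • modeRep W₁ n 𝔹 F u (K0 + j • (fun i => (W₁.phase s).m i * (n : ℤ))) t‖ ^ 2)] at hB
    exact hB
  -- everywhere by continuity
  have hc5 : ContinuousOn (fun t => 2 * (‖((σ : ℂ) * starRingEnd ℂ (Complex.exp ((W₁.phase s).φ * Complex.I))) ^ (0:ℤ) • modeRep W₁ n 𝔹 F u (K0 + (0:ℤ) • (fun i => (W₁.phase s).m i * (n : ℤ))) t‖ ^ 2 + ‖((σ : ℂ) * starRingEnd ℂ (Complex.exp ((W₁.phase s).φ * Complex.I))) ^ (1:ℤ) • modeRep W₁ n 𝔹 F u (K0 + (1:ℤ) • (fun i => (W₁.phase s).m i * (n : ℤ))) t‖ ^ 2 + ‖((σ : ℂ) * starRingEnd ℂ (Complex.exp ((W₁.phase s).φ * Complex.I))) ^ (-1:ℤ) • modeRep W₁ n 𝔹 F u (K0 + (-1:ℤ) • (fun i => (W₁.phase s).m i * (n : ℤ)))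 t‖ ^ 2 + ‖((σ : ℂ) * starRingEnd ℂ (Complex.exp ((W₁.phase s).φ * Complex.I))) ^ (2:ℤ) • modeRep W₁ n 𝔹 F u (K0 + (2:ℤ) • (fun i => (W₁.phase s).m i * (n : ℤ))) t‖ ^ 2 + ‖((σ : ℂ) * starRingEnd ℂ (Complex.exp ((W₁.phase s).φ * Complex.I))) ^ (-2:ℤ) • modeRep W₁ n 𝔹 F u (K0 + (-2:ℤ) • (fun i => (W₁.phase s).m i * (n : ℤ))) t‖ ^ 2)) (Icc 0 T) := by
    refine continuousOn_const.mul ?_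
    exact ((((continuousOn_norm_sq_gauge_modeRep W₁ n hT.le h _ _).add (continuousOn_norm_sq_gauge_modeRep W₁ n hT.le h _ _)).add
      (continuousOn_norm_sq_gauge_modeRep W₁ n hT.le h _ _)).add (continuousOn_norm_sq_gauge_modeRep W₁ n hT.le h _ _)).add
      (continuousOn_norm_sq_gauge_modeRep W₁ n hT.le h _ _)
  exact le_on_Icc_of_ae_le hT hc5 hEc hae

/-! ## §5 The conjugate-pair dissipation split on `uIcc t₀ t₁` (slot_step's `hQ`, multiplicity `2`) -/

/-- **`hQ` of `slot_step` (μ = 2)** on the window `[t₀,t₁] ⊆ [0,T]`, in its five-term order. [cite: BedrossianCotiZelati2017, §2 (hypocoercivity functional with a cross term)] -/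
theorem ae_uIcc_pair_split (W₁ : LatticeWord k₀) (n : ℕ) {T : ℝ} (hT : 0 ≤ T) {𝔹 : Torus.Visc4 (Fin 3)}
    {F : UnitAddTorus (Fin 3) → EuclideanSpace ℝ (Fin 3)} {u : ℝ → UnitAddTorus (Fin 3) → EuclideanSpace ℝ (Fin 3)}
    (h : Torus.IsWeakTensorPassiveVectorOn 0 T 𝔹 (W₁.cell n) F u) (hF : Integrable F volume) {lo hi : ℝ}
    (h𝔹 : Torus.NearIso 𝔹 lo hi) (s : Fin k₀) (K0 : Fin 3 → ℤ) {σ : ℝ} (hσ : σ = 1 ∨ σ = -1) (hKs : (fun i => (W₁.phase s).m i * (n : ℤ)) ≠ 0)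
    (hdisj : ∀ j ∈ ({-2, -1, 0, 1, 2} : Finset ℤ), ∀ j' ∈ ({-2, -1, 0, 1, 2} : Finset ℤ),
      K0 + j • (fun i => (W₁.phase s).m i * (n : ℤ)) ≠ -(K0 + j' • (fun i => (W₁.phase s).m i * (n : ℤ))))
    {E Q : ℝ → ℝ} (hE : ∀ᵐ t ∂(volume.restrict (Ioo 0 T)), E t = ∫ x, ‖u t x‖ ^ 2)
    (hQ : ∀ᵐ t ∂(volume.restrict (Ioo 0 T)), ∀ S : Finset (Fin 3 → ℤ),
      4 * Real.pi ^ 2 * ∑ k ∈ S, (⟪mFourierCoeff (EuclideanSpace.complexify ∘ u t) k,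
        Torus.symbT 𝔹 k (mFourierCoeff (EuclideanSpace.complexify ∘ u t) k)⟫_ℂ).re ≤ Q t)
    {dmin : ℝ} (hdmin : 0 ≤ dmin)
    (hgap : ∀ᵐ t ∂(volume.restrict (Ioo 0 T)), ∀ k : Fin 3 → ℤ,
      (∀ j ∈ ({-2, -1, 0, 1, 2} : Finset ℤ), k ≠ K0 + j • (fun i => (W₁.phase s).m i * (n : ℤ)) ∧ k ≠ -(K0 + j • (fun i => (W₁.phase s).m i * (n : ℤ)))) →
      mFourierCoeff (EuclideanSpace.complexify ∘ u t) k ≠ 0 → dmin ≤ 8 * Real.pi ^ 2 * lo * freqNormSq k)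
    {t₀ t₁ : ℝ} (h0 : 0 ≤ t₀) (h01 : t₀ ≤ t₁) (h1 : t₁ ≤ T) :
    ∀ᵐ t ∂(volume : Measure ℝ), t ∈ uIcc t₀ t₁ →
      2 * ((⟪Torus.modalAdjGen (Torus.majorTranspose 𝔹) (K0 + (0:ℤ) • (fun i => (W₁.phase s).m i * (n : ℤ))) (((σ : ℂ) * starRingEnd ℂ (Complex.exp ((W₁.phase s).φ * Complex.I))) ^ (0:ℤ) • modeRep W₁ n 𝔹 F u (K0 + (0:ℤ) • (fun i => (W₁.phase s).m i * (n : ℤ))) t), ((σ : ℂ) * starRingEnd ℂ (Complex.exp ((W₁.phase s).φ * Complex.I))) ^ (0:ℤ) • modeRep W₁ n 𝔹 F u (K0 + (0:ℤ) • (fun i => (W₁.phase s).m i * (n : ℤ))) t⟫_ℂ).re + (⟪Torus.modalAdjGen (Torus.majorTranspose 𝔹) (K0 + (1:ℤ) • (fun i => (W₁.phase s).m i * (n : ℤ))) (((σ : ℂ) * starRingEnd ℂ (Complex.exp ((W₁.phase s).φ * Complex.I))) ^ (1:ℤ) • modeRep W₁ n 𝔹 F u (K0 + (1:ℤ) • (fun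 i => (W₁.phase s).m i * (n : ℤ))) t), ((σ : ℂ) * starRingEnd ℂ (Complex.exp ((W₁.phase s).φ * Complex.I))) ^ (1:ℤ) • modeRep W₁ n 𝔹 F u (K0 + (1:ℤ) • (fun i => (W₁.phase s).m i * (n : ℤ))) t⟫_ℂ).re + (⟪Torus.modalAdjGen (Torus.majorTranspose 𝔹) (K0 + (-1:ℤ) • (fun i => (W₁.phase s).m i * (n : ℤ))) (((σ : ℂ) * starRingEnd ℂ (Complex.exp ((W₁.phase s).φ * Complex.I))) ^ (-1:ℤ) • modeRep W₁ n 𝔹 F u (K0 + (-1:ℤ) • (fun i => (W₁.phase s).m i * (n : ℤ))) t), ((σ : ℂ) * starRingEnd ℂ (Complex.exp ((W₁.phase s).φ * Complex.I))) ^ (-1:ℤ) • modeRep W₁ n 𝔹 F u (K0 + (-1:ℤ) • (fun i => (W₁.phase s).m i * (n : ℤ))) t⟫_ℂ).re + (⟪Torus.modalAdjGen (Torus.majorTranspose 𝔹) (K0 + (2:ℤ) • (fun i => (W₁.phase s).m i * (n : ℤ))) (((σ : ℂ) * starRingEnd ℂ (Complex.exp ((W₁.phase s).φ * Complex.I)))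 ^ (2:ℤ) • modeRep W₁ n 𝔹 F u (K0 + (2:ℤ) • (fun i => (W₁.phase s).m i * (n : ℤ))) t), ((σ : ℂ) * starRingEnd ℂ (Complex.exp ((W₁.phase s).φ * Complex.I))) ^ (2:ℤ) • modeRep W₁ n 𝔹 F u (K0 + (2:ℤ) • (fun i => (W₁.phase s).m i * (n : ℤ))) t⟫_ℂ).re + (⟪Torus.modalAdjGen (Torus.majorTranspose 𝔹) (K0 + (-2:ℤ) • (fun i => (W₁.phase s).m i * (n : ℤ))) (((σ : ℂ) * starRingEnd ℂ (Complex.exp ((W₁.phase s).φ * Complex.I))) ^ (-2:ℤ) • modeRep W₁ n 𝔹 F u (K0 + (-2:ℤ) • (fun i => (W₁.phase s).m i * (n : ℤ))) t), ((σ : ℂ) * starRingEnd ℂ (Complex.exp ((W₁.phase s).φ * Complex.I))) ^ (-2:ℤ) • modeRep W₁ n 𝔹 F u (K0 + (-2:ℤ) • (fun i => (W₁.phase s).m i * (n : ℤ))) t⟫_ℂ).re) + dmin / 2 * (E t - 2 * (‖((σ : ℂ) * starRingEnd ℂ (Complex.exp ((W₁.phase s).φ * Complex.I))) ^ (0:ℤ)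 • modeRep W₁ n 𝔹 F u (K0 + (0:ℤ) • (fun i => (W₁.phase s).m i * (n : ℤ))) t‖ ^ 2 + ‖((σ : ℂ) * starRingEnd ℂ (Complex.exp ((W₁.phase s).φ * Complex.I))) ^ (1:ℤ) • modeRep W₁ n 𝔹 F u (K0 + (1:ℤ) • (fun i => (W₁.phase s).m i * (n : ℤ))) t‖ ^ 2 + ‖((σ : ℂ) * starRingEnd ℂ (Complex.exp ((W₁.phase s).φ * Complex.I))) ^ (-1:ℤ) • modeRep W₁ n 𝔹 F u (K0 + (-1:ℤ) • (fun i => (W₁.phase s).m i * (n : ℤ))) t‖ ^ 2 + ‖((σ : ℂ) * starRingEnd ℂ (Complex.exp ((W₁.phase s).φ * Complex.I))) ^ (2:ℤ) • modeRep W₁ n 𝔹 F u (K0 + (2:ℤ) • (fun i => (W₁.phase s).m i * (n : ℤ))) t‖ ^ 2 + ‖((σ : ℂ) * starRingEnd ℂ (Complex.exp ((W₁.phase s).φ * Complex.I))) ^ (-2:ℤ) • modeRep W₁ n 𝔹 F u (K0 + (-2:ℤ) • (fun i => (W₁.phase s).m i * (n : ℤ))) t‖ ^ 2)) ≤ Q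 t := by
  have hsplit := ae_pair_dissipation_split_rep W₁ n hT h hF h𝔹 hE hQ K0 (fun i => (W₁.phase s).m i * (n : ℤ)) hKs hdisj hσ (W₁.phase s).φ hdmin hgap
  refine ae_uIcc_of_ae_Ioo h0 h01 h1 (hsplit.mono fun t ht => ?_)
  rw [sum_S5_eq, sum_S5_eq] at ht
  exact ht

end Summit.AnomalousDissipation.AnomalousDissipation.Theorems.SolenoidalFractalHomogenisation.LagrangianStep.CellChain

end
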